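import Mathlib
import HarnessLib

/-!
# The integrable majorant for the Abelian summation

Helper file for item `stmt-CriticalPhenomena-8360`
(`Summit.CriticalPhenomena.Ising3DConformalLimit.Theses.BernsteinTemperature.KernelTransfer`).

With `e₂ = γ - 1 - 3ν < -1` and `e₁ = e₂ + νp ∈ (-1, 0)`, the summand
`|x|^{3-γ/ν} · |x|^{1/ν} · s_n q_n(x)` of the rescaled series, read in the variable
`t = n / |x|^{1/ν}`, is bounded by `(A C₁/2) φ(t)` with `φ(t) = t^{e₂} (1 + t^{-ν})^{-p} ≤
min(t^{e₁}, t^{e₂})`; since the order `n ∈ {2k, 2k+1}` attached to the cell of `u` satisfies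
`n/|x|^{1/ν} ≥ u/3`, the step function is dominated by the integrable profile
`ψ(u) = (u/3)^{e₁}` (`u ≤ 3`), `(u/3)^{e₂}` (`u > 3`). This file proves these elementary real
inequalities and the integrability of `ψ` on `(0, ∞)`, and then (section `Pointwise`) the pointwise
limit of the rescaled step function along the filter. No definitions are introduced.
-/

noncomputable section

namespace Summit.CriticalPhenomena.Ising3DConformalLimit.Theorems.KernelTransfer

open Filter Topology MeasureTheory Set

/-! ### Elementary `rpow` facts -/

/-- `φ(t) = t^{e₂} (1 + t^{-ν})^{-p} ≤ t^{e₂}` for `t > 0`, `p ≥ 0`. -/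
theorem phi_le_rpow {t ν p e₂ : ℝ} (ht : 0 < t) (hp : 0 ≤ p) :
    t ^ e₂ * (1 + t ^ (-ν)) ^ (-p) ≤ t ^ e₂ := by
  refine mul_le_of_le_one_right (Real.rpow_nonneg ht.le _) ?_
  exact Real.rpow_le_one_of_one_le_of_nonpos (by linarith [Real.rpow_nonneg ht.le (-ν)])
    (by linarith)

/-- `φ(t) = t^{e₂} (1 + t^{-ν})^{-p} ≤ t^{e₂ + νp}` for `t > 0`, `p ≥ 0`. -/
theorem phi_le_rpow_add {t ν p e₂ : ℝ} (ht : 0 < t) (hp : 0 ≤ p) :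
    t ^ e₂ * (1 + t ^ (-ν)) ^ (-p) ≤ t ^ (e₂ + ν * p) := by
  rw [Real.rpow_add ht]
  refine mul_le_mul_of_nonneg_left ?_ (Real.rpow_nonneg ht.le _)
  have h1 : (1 + t ^ (-ν)) ^ (-p) ≤ (t ^ (-ν)) ^ (-p) :=
    Real.rpow_le_rpow_of_nonpos (Real.rpow_pos_of_pos ht _) (by linarith) (by linarith)
  refine h1.trans_eq ?_
  rw [← Real.rpow_mul ht.le]
  ring_nf

/-- For `e ≤ 0` and `0 < u/3 ≤ t`: `t^e ≤ (u/3)^e`. -/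
theorem rpow_le_rpow_div_three {t u e : ℝ} (hu : 0 < u) (htu : u / 3 ≤ t) (he : e ≤ 0) :
    t ^ e ≤ (u / 3) ^ e :=
  Real.rpow_le_rpow_of_nonpos (div_pos hu (by norm_num)) htu he

/-- **`φ ≤ ψ`.** For `t ≥ u/3 > 0`, `p ≥ 0`, `e₂ ≤ 0` and `e₂ + νp ≤ 0`:
`t^{e₂}(1 + t^{-ν})^{-p} ≤ ψ(u)`, `ψ(u) = (u/3)^{e₂+νp}` for `u ≤ 3` and `(u/3)^{e₂}` for `u > 3`. -/
theorem phi_le_psi {t u ν p e₂ : ℝ} (hu : 0 < u) (htu : u / 3 ≤ t) (hp : 0 ≤ p) (he₂ : e₂ ≤ 0)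
    (he₁ : e₂ + ν * p ≤ 0) :
    t ^ e₂ * (1 + t ^ (-ν)) ^ (-p) ≤
      (if u ≤ 3 then (u / 3) ^ (e₂ + ν * p) else (u / 3) ^ e₂) := by
  have ht : 0 < t := lt_of_lt_of_le (by positivity) htu
  split_ifs with h
  · exact (phi_le_rpow_add ht hp).trans (rpow_le_rpow_div_three hu htu he₁)
  · exact (phi_le_rpow ht hp).trans (rpow_le_rpow_div_three hu htu he₂)

/-- `ψ ≥ 0`. -/
theorem psi_nonneg {u ν p e₂ : ℝ} (hu : 0 < u) :
    0 ≤ (if u ≤ 3 then (u / 3) ^ (e₂ + ν * p) else (u / 3) ^ e₂) := by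
  split_ifs <;> positivity

/-! ### The order attached to a cell -/

/-- If `k = ⌊uL/2⌋` (`L > 0`) and `n ∈ {2k, 2k+1}` with `n ≥ 1`, then `n/L ≥ u/3`
(if `uL < 3` because `n ≥ 1`; otherwise because `n ≥ 2k > uL - 2 ≥ uL/3`). -/
theorem div_three_le_div {L u : ℝ} (hL : 0 < L) {n : ℕ} (hn1 : 1 ≤ n)
    (hn : 2 * ⌊u * L / 2⌋₊ ≤ n) : u / 3 ≤ (n : ℝ) / L := by
  have hk : u * L / 2 < ⌊u * L / 2⌋₊ + 1 := Nat.lt_floor_add_one _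
  have hn' : (2 : ℝ) * ⌊u * L / 2⌋₊ ≤ n := by exact_mod_cast hn
  have hn1' : (1 : ℝ) ≤ n := by exact_mod_cast hn1
  rw [div_le_div_iff₀ (by norm_num : (0 : ℝ) < 3) hL]
  rcases lt_or_ge (u * L) 3 with h3 | h3
  · nlinarith
  · nlinarith

/-- If `k = ⌊uL/2⌋` (`u, L ≥ 0`) and `n ≤ 2k + 1`, then `n ≤ uL + 1`. -/
theorem natCast_le_mul_add_one {L u : ℝ} (hL : 0 ≤ L) (hu : 0 ≤ u) {n : ℕ}
    (hn : n ≤ 2 * ⌊u * L / 2⌋₊ + 1) : (n : ℝ) ≤ u * L + 1 := by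
  have hk : (⌊u * L / 2⌋₊ : ℝ) ≤ u * L / 2 := Nat.floor_le (by positivity)
  have hn' : (n : ℝ) ≤ 2 * ⌊u * L / 2⌋₊ + 1 := by exact_mod_cast hn
  linarith

/-- If `k = ⌊uL/2⌋` and `2k ≤ n`, then `uL - 2 < n`. -/
theorem mul_sub_two_lt_natCast {L u : ℝ} {n : ℕ} (hn : 2 * ⌊u * L / 2⌋₊ ≤ n) :
    u * L - 2 < n := by
  have hk : u * L / 2 < ⌊u * L / 2⌋₊ + 1 := Nat.lt_floor_add_one _
  have hn' : (2 : ℝ) * ⌊u * L / 2⌋₊ ≤ n := by exact_mod_cast hn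
  linarith

/-! ### Rescaling identities -/

/-- `(r^{1/ν})^ν = r` for `r ≥ 0`, `ν ≠ 0`. -/
theorem rpow_one_div_rpow {r ν : ℝ} (hr : 0 ≤ r) (hν : ν ≠ 0) : (r ^ (1 / ν)) ^ ν = r := by
  rw [← Real.rpow_mul hr, one_div, inv_mul_cancel₀ hν, Real.rpow_one]

/-- `r / n^ν = (n / r^{1/ν})^{-ν}` for `r > 0`, `n > 0`, `ν ≠ 0`. -/
theorem div_rpow_eq_rpow_neg {r ν n : ℝ} (hr : 0 < r) (hn : 0 < n) (hν : ν ≠ 0) :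
    r / n ^ ν = (n / r ^ (1 / ν)) ^ (-ν) := by
  rw [Real.rpow_neg (by positivity), Real.div_rpow hn.le (by positivity),
    rpow_one_div_rpow hr.le hν, inv_div]

/-- `r^{3-γ/ν} · r^{1/ν} · n^{γ-1-3ν} = (n / r^{1/ν})^{γ-1-3ν}` for `r > 0`, `n > 0`, `ν ≠ 0`. -/
theorem rescale_rpow_eq {r ν γ n : ℝ} (hr : 0 < r) (hn : 0 < n) (hν : ν ≠ 0) :
    r ^ (3 - γ / ν) * r ^ (1 / ν) * n ^ (γ - 1 - 3 * ν) =
      (n / r ^ (1 / ν)) ^ (γ - 1 - 3 * ν) := by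
  rw [Real.div_rpow hn.le (by positivity), ← Real.rpow_mul hr.le,
    div_eq_mul_inv ((n : ℝ) ^ (γ - 1 - 3 * ν)), ← Real.rpow_neg hr.le, ← Real.rpow_add hr,
    mul_comm (n ^ (γ - 1 - 3 * ν)),
    show (3 - γ / ν + 1 / ν : ℝ) = -(1 / ν * (γ - 1 - 3 * ν)) by field_simp; ring]

/-! ### Domination of one term -/

/-- From the tail bound `n^{3ν} a / S ≤ A (1 + r/n^ν)^{-p}` with `0 ≤ a ≤ S`:
`a ≤ S · A · n^{-3ν} (1 + r/n^ν)^{-p}` (also when `S = 0`, for then `a = 0`). -/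
theorem le_of_tail {a S A r ν p n : ℝ} (hn : 0 < n) (ha : 0 ≤ a) (haS : a ≤ S)
    (htail : n ^ (3 * ν) * a / S ≤ A * (1 + r / n ^ ν) ^ (-p)) :
    a ≤ S * (A * n ^ (-(3 * ν)) * (1 + r / n ^ ν) ^ (-p)) := by
  rcases (ha.trans haS).lt_or_eq with hS | hS
  · have h1 : n ^ (3 * ν) * a ≤ A * (1 + r / n ^ ν) ^ (-p) * S := (div_le_iff₀ hS).1 htail
    have hpow : 0 < n ^ (3 * ν) := Real.rpow_pos_of_pos hn _
    rw [Real.rpow_neg hn.le]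
    calc a = n ^ (3 * ν) * a / n ^ (3 * ν) := by field_simp
      _ ≤ A * (1 + r / n ^ ν) ^ (-p) * S / n ^ (3 * ν) := div_le_div_of_nonneg_right h1 hpow.le
      _ = S * (A * (n ^ (3 * ν))⁻¹ * (1 + r / n ^ ν) ^ (-p)) := by
          rw [div_eq_mul_inv]
          ring
  · rw [← hS] at haS ⊢
    have : a = 0 := le_antisymm haS ha
    simp [this]

/-- **Domination of one term of the rescaled series.** With `L = r^{1/ν}` (`r > 0`, `ν > 0`),
a natural `n ≥ 1`, `0 ≤ a ≤ S`, `0 ≤ v`, the tail bound `n^{3ν} a/S ≤ A(1 + r/n^ν)^{-p}`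
(`A ≥ 0`) and the growth bound `vⁿ S ≤ C₁ n^{γ-1}`:
`r^{3-γ/ν} (L/2) (a vⁿ) ≤ (A C₁ / 2) φ(n/L)`, `φ(t) = t^{γ-1-3ν}(1 + t^{-ν})^{-p}`. -/
theorem term_le_phi {r ν γ p A C₁ v a S : ℝ} {n : ℕ} (hr : 0 < r) (hν : 0 < ν) (hn : 1 ≤ n)
    (ha : 0 ≤ a) (haS : a ≤ S) (hv : 0 ≤ v) (hA : 0 ≤ A)
    (htail : (n : ℝ) ^ (3 * ν) * a / S ≤ A * (1 + r / (n : ℝ) ^ ν) ^ (-p))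
    (hgrowth : v ^ n * S ≤ C₁ * (n : ℝ) ^ (γ - 1)) :
    r ^ (3 - γ / ν) * (r ^ (1 / ν) / 2 * (a * v ^ n)) ≤
      A * C₁ / 2 * (((n : ℝ) / r ^ (1 / ν)) ^ (γ - 1 - 3 * ν) *
        (1 + ((n : ℝ) / r ^ (1 / ν)) ^ (-ν)) ^ (-p)) := by
  have hn0 : (0 : ℝ) < n := by exact_mod_cast hn
  have hS0 : 0 ≤ S := ha.trans haS
  set W : ℝ := (1 + r / (n : ℝ) ^ ν) ^ (-p) with hW
  have hW0 : 0 ≤ W := Real.rpow_nonneg (by positivity) _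
  -- `a vⁿ ≤ C₁ n^{γ-1} · A n^{-3ν} W`
  have h1 : a ≤ S * (A * (n : ℝ) ^ (-(3 * ν)) * W) := le_of_tail hn0 ha haS htail
  have h2 : a * v ^ n ≤ C₁ * (n : ℝ) ^ (γ - 1) * (A * (n : ℝ) ^ (-(3 * ν)) * W) := by
    calc a * v ^ n ≤ S * (A * (n : ℝ) ^ (-(3 * ν)) * W) * v ^ n :=
          mul_le_mul_of_nonneg_right h1 (pow_nonneg hv n)
      _ = v ^ n * S * (A * (n : ℝ) ^ (-(3 * ν)) * W) := by ring
      _ ≤ C₁ * (n : ℝ) ^ (γ - 1) * (A * (n : ℝ) ^ (-(3 * ν)) * W) :=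
          mul_le_mul_of_nonneg_right hgrowth (by positivity)
  -- rewrite the right-hand side with the rescaling identities
  have hI1 := rescale_rpow_eq (γ := γ) hr hn0 hν.ne'
  have hI2 := div_rpow_eq_rpow_neg hr hn0 hν.ne'
  rw [← hI2, ← hW, ← hI1]
  have hsplit : (n : ℝ) ^ (γ - 1 - 3 * ν) = (n : ℝ) ^ (γ - 1) * (n : ℝ) ^ (-(3 * ν)) := by
    rw [← Real.rpow_add hn0]; ring_nf
  rw [hsplit]
  calc r ^ (3 - γ / ν) * (r ^ (1 / ν) / 2 * (a * v ^ n))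
        = r ^ (3 - γ / ν) * r ^ (1 / ν) / 2 * (a * v ^ n) := by ring
    _ ≤ r ^ (3 - γ / ν) * r ^ (1 / ν) / 2 *
          (C₁ * (n : ℝ) ^ (γ - 1) * (A * (n : ℝ) ^ (-(3 * ν)) * W)) :=
          mul_le_mul_of_nonneg_left h2 (by positivity)
    _ = A * C₁ / 2 * (r ^ (3 - γ / ν) * r ^ (1 / ν) *
          ((n : ℝ) ^ (γ - 1) * (n : ℝ) ^ (-(3 * ν))) * W) := by ring

/-! ### Integrability of the majorant -/

/-- **`ψ` is integrable on `(0, ∞)`**: `ψ(u) = (u/3)^{e₁}` for `u ≤ 3`, `(u/3)^{e₂}` for `u > 3`,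
with `-1 < e₁` and `e₂ < -1`. -/
theorem integrableOn_psi {e₁ e₂ : ℝ} (he₁ : -1 < e₁) (he₂ : e₂ < -1) :
    IntegrableOn (fun u : ℝ => if u ≤ 3 then (u / 3) ^ e₁ else (u / 3) ^ e₂) (Ioi 0) := by
  rw [← Ioc_union_Ioi_eq_Ioi (by norm_num : (0 : ℝ) ≤ 3)]
  refine IntegrableOn.union ?_ ?_
  · -- on `(0, 3]`: `(u/3)^{e₁} = u^{e₁} / 3^{e₁}`
    have h1 : IntegrableOn (fun u : ℝ => u ^ e₁ / 3 ^ e₁) (Ioc 0 3) := by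
      have h := (intervalIntegral.intervalIntegrable_rpow' (a := 0) (b := 3) he₁)
      rw [intervalIntegrable_iff_integrableOn_Ioc_of_le (by norm_num)] at h
      exact h.div_const _
    refine h1.congr_fun (fun u hu => ?_) measurableSet_Ioc
    simp only [if_pos hu.2, Real.div_rpow hu.1.le (by norm_num : (0 : ℝ) ≤ 3)]
  · -- on `(3, ∞)`: `(u/3)^{e₂} = u^{e₂} / 3^{e₂}`
    have h1 : IntegrableOn (fun u : ℝ => u ^ e₂ / 3 ^ e₂) (Ioi 3) :=
      (integrableOn_Ioi_rpow_of_lt he₂ (by norm_num)).div_const _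
    refine h1.congr_fun (fun u hu => ?_) measurableSet_Ioi
    have hu3 : (3 : ℝ) < u := hu
    simp only [if_neg (not_le.2 hu3), Real.div_rpow (by linarith : (0 : ℝ) ≤ u)
      (by norm_num : (0 : ℝ) ≤ 3)]

/-! ### Pointwise limit of the rescaled step function

Abstract setting: an index set `X` with a filter `l` along which the "radius" `r x → ∞`, a parity
`m x ∈ ℕ`, non-negative coefficients `a x n` vanishing unless `n ≡ m x (mod 2)`, their totals `S n`,
and the edge variable `v`. Under regular variation `vⁿ S n / n^{γ-1} → C` and the local limit
`|n^{3ν} a x n / (2 S n) - Q(r x / n^ν)| → 0` uniformly on `r x ≤ R n^ν`, the step function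
`u ↦ r^{3-γ/ν} (L/2) (b_{2k} + b_{2k+1})` (`L = r^{1/ν}`, `k = ⌊uL/2⌋`, `b_n = a x n vⁿ`) converges,
for every fixed `u > 0`, to `C u^{γ-1-3ν} Q(u^{-ν})` along `l` (`tendsto_step_pointwise`): exactly one
of the two orders `2k, 2k+1` has the right parity, it satisfies `n/L → u`, and the three factors
`vⁿ S_n / n^{γ-1}`, `(n/L)^{γ-1-3ν}`, `n^{3ν} a x n / (2 S_n)` converge separately. -/

section Pointwise

variable {X : Type*}

/-- The order of the right parity among `{2k, 2k+1}`: with `π = 0` if `m` is even and `π = 1`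
otherwise, `2k + π + m` is even. -/
theorem even_two_mul_add_ite_add (k m : ℕ) :
    Even (2 * k + (if Even m then 0 else 1) + m) := by
  by_cases hm : Even m
  · rw [if_pos hm, Nat.even_iff]
    rw [Nat.even_iff] at hm
    omega
  · rw [if_neg hm, Nat.even_iff]
    rw [Nat.even_iff] at hm
    omega

/-- Parity kills the other order: the two-term cell sum `b_{2k} + b_{2k+1}` equals the single term
of the right parity `b_{2k+π}`. -/
theorem cell_sum_eq_single {m : ℕ} {b : ℕ → ℝ} (hpar : ∀ n, ¬ Even (n + m) → b n = 0) (k : ℕ) :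
    b (2 * k) + b (2 * k + 1) = b (2 * k + if Even m then 0 else 1) := by
  by_cases hm : Even m
  · rw [if_pos hm, add_zero, hpar (2 * k + 1), add_zero]
    rw [Nat.even_iff] at hm ⊢
    omega
  · rw [if_neg hm, hpar (2 * k), zero_add]
    rw [Nat.even_iff] at hm ⊢
    omega

/-- **Pointwise limit of the rescaled step function.** See the module docstring. -/
theorem tendsto_step_pointwise {l : Filter X} {r : X → ℝ} {m : X → ℕ} {a : X → ℕ → ℝ}
    {S : ℕ → ℝ} {v ν γ C : ℝ} {Q : ℝ → ℝ} (hν : 0 < ν) (hC : 0 < C)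
    (hQc : ContinuousOn Q (Ici 0)) (hr : Tendsto r l atTop)
    (hpar : ∀ x n, ¬ Even (n + m x) → a x n = 0)
    (hRV : Tendsto (fun n : ℕ => v ^ n * S n / (n : ℝ) ^ (γ - 1)) atTop (𝓝 C))
    (hLL : ∀ R ε : ℝ, 0 < R → 0 < ε → ∀ᶠ n : ℕ in atTop, ∀ x, r x ≤ R * (n : ℝ) ^ ν →
      Even (n + m x) → |(n : ℝ) ^ (3 * ν) * a x n / (2 * S n) - Q (r x / (n : ℝ) ^ ν)| ≤ ε)
    {u : ℝ} (hu : 0 < u) :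
    Tendsto (fun x => r x ^ (3 - γ / ν) * (r x ^ (1 / ν) / 2 *
        (a x (2 * ⌊u * r x ^ (1 / ν) / 2⌋₊) * v ^ (2 * ⌊u * r x ^ (1 / ν) / 2⌋₊) +
          a x (2 * ⌊u * r x ^ (1 / ν) / 2⌋₊ + 1) * v ^ (2 * ⌊u * r x ^ (1 / ν) / 2⌋₊ + 1))))
      l (𝓝 (C * u ^ (γ - 1 - 3 * ν) * Q (u ^ (-ν)))) := by
  -- the order of the right parity attached to the cell of `u`
  obtain ⟨L, hL⟩ : ∃ L : X → ℝ, ∀ x, L x = r x ^ (1 / ν) := ⟨_, fun _ => rfl⟩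
  obtain ⟨n, hn⟩ : ∃ n : X → ℕ, ∀ x, n x = 2 * ⌊u * L x / 2⌋₊ + (if Even (m x) then 0 else 1) :=
    ⟨_, fun _ => rfl⟩
  have hn_even : ∀ x, Even (n x + m x) := fun x => by
    rw [hn]
    exact even_two_mul_add_ite_add _ _
  have hn_lo : ∀ x, 2 * ⌊u * L x / 2⌋₊ ≤ n x := fun x => by rw [hn]; exact Nat.le_add_right _ _
  have hn_hi : ∀ x, n x ≤ 2 * ⌊u * L x / 2⌋₊ + 1 := fun x => by
    rw [hn]
    split_ifs <;> omega
  -- the cell sum is the single term at `n x`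
  have hcell : ∀ x, a x (2 * ⌊u * L x / 2⌋₊) * v ^ (2 * ⌊u * L x / 2⌋₊) +
      a x (2 * ⌊u * L x / 2⌋₊ + 1) * v ^ (2 * ⌊u * L x / 2⌋₊ + 1) = a x (n x) * v ^ (n x) := by
    intro x
    rw [hn]
    exact cell_sum_eq_single (b := fun n => a x n * v ^ n)
      (fun n hn' => by simp [hpar x n hn']) _
  -- `L → ∞`, `n → ∞`, `n / L → u`
  have hLt : Tendsto L l atTop := by
    rw [show L = fun x => r x ^ (1 / ν) from funext hL]
    exact (tendsto_rpow_atTop (by positivity)).comp hr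
  have hLpos : ∀ᶠ x in l, 0 < L x := hLt.eventually_gt_atTop 0
  have hn_gt : ∀ x, u * L x - 2 < n x := fun x => mul_sub_two_lt_natCast (hn_lo x)
  have hnt : Tendsto (fun x => (n x : ℝ)) l atTop := by
    have h : Tendsto (fun x => u * L x + (-2)) l atTop :=
      tendsto_atTop_add_const_right l (-2) (hLt.const_mul_atTop hu)
    exact tendsto_atTop_mono (fun x => by linarith [hn_gt x]) h
  have hnt' : Tendsto n l atTop := tendsto_natCast_atTop_iff.1 hnt
  have ht : Tendsto (fun x => (n x : ℝ) / L x) l (𝓝 u) := by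
    have h1 : Tendsto (fun x => u - 2 / L x) l (𝓝 u) := by
      simpa using (tendsto_const_nhds (x := u)).sub (tendsto_const_nhds.div_atTop hLt)
    have h2 : Tendsto (fun x => u + 1 / L x) l (𝓝 u) := by
      simpa using (tendsto_const_nhds (x := u)).add
        ((tendsto_const_nhds (x := (1 : ℝ))).div_atTop hLt)
    refine tendsto_of_tendsto_of_tendsto_of_le_of_le' h1 h2 ?_ ?_
    · filter_upwards [hLpos] with x hx
      rw [le_div_iff₀ hx, show (u - 2 / L x) * L x = u * L x - 2 by field_simp]
      exact (hn_gt x).le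
    · filter_upwards [hLpos] with x hx
      have := natCast_le_mul_add_one hx.le hu.le (hn_hi x)
      rw [div_le_iff₀ hx, add_mul, div_mul_cancel₀ _ hx.ne']
      linarith
  -- the three factors
  have hσ : Tendsto (fun x => v ^ (n x) * S (n x) / (n x : ℝ) ^ (γ - 1)) l (𝓝 C) := hRV.comp hnt'
  have hte₂ : Tendsto (fun x => ((n x : ℝ) / L x) ^ (γ - 1 - 3 * ν)) l (𝓝 (u ^ (γ - 1 - 3 * ν))) :=
    ((Real.continuousAt_rpow_const u _ (Or.inl hu.ne')).tendsto).comp ht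
  have htν : Tendsto (fun x => ((n x : ℝ) / L x) ^ (-ν)) l (𝓝 (u ^ (-ν))) :=
    ((Real.continuousAt_rpow_const u _ (Or.inl hu.ne')).tendsto).comp ht
  have hQt : Tendsto (fun x => Q (((n x : ℝ) / L x) ^ (-ν))) l (𝓝 (Q (u ^ (-ν)))) := by
    refine ((hQc _ (Real.rpow_nonneg hu.le _)).tendsto).comp ?_
    rw [tendsto_nhdsWithin_iff]
    refine ⟨htν, ?_⟩
    filter_upwards [hLpos] with x hx
    exact Real.rpow_nonneg (div_nonneg (Nat.cast_nonneg _) hx.le) _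
  -- the kernel factor: `n^{3ν} a / (2S) - Q((n/L)^{-ν}) → 0`
  have hρ : Tendsto (fun x => (n x : ℝ) ^ (3 * ν) * a x (n x) / (2 * S (n x)) -
      Q (((n x : ℝ) / L x) ^ (-ν))) l (𝓝 0) := by
    rw [Metric.tendsto_nhds]
    intro ε hε
    have hRpos : 0 < u ^ (-ν) + 1 := by positivity
    have hev : ∀ᶠ x in l, ∀ y, r y ≤ (u ^ (-ν) + 1) * (n x : ℝ) ^ ν → Even (n x + m y) →
        |(n x : ℝ) ^ (3 * ν) * a y (n x) / (2 * S (n x)) - Q (r y / (n x : ℝ) ^ ν)| ≤ ε / 2 :=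
      hnt'.eventually (hLL _ _ hRpos (half_pos hε))
    have hRev : ∀ᶠ x in l, ((n x : ℝ) / L x) ^ (-ν) < u ^ (-ν) + 1 :=
      htν.eventually (gt_mem_nhds (by linarith))
    filter_upwards [hev, hRev, hr.eventually_gt_atTop 0, hnt'.eventually_ge_atTop 1]
      with x hx hRx hrx hnx
    have hn0 : (0 : ℝ) < n x := by exact_mod_cast hnx
    have hid : r x / (n x : ℝ) ^ ν = ((n x : ℝ) / L x) ^ (-ν) := by
      rw [hL]; exact div_rpow_eq_rpow_neg hrx hn0 hν.ne'
    have hcond : r x ≤ (u ^ (-ν) + 1) * (n x : ℝ) ^ ν := by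
      rw [← div_le_iff₀ (Real.rpow_pos_of_pos hn0 _), hid]
      exact hRx.le
    have h := hx x hcond (hn_even x)
    rw [hid] at h
    rw [dist_zero_right, Real.norm_eq_abs]
    linarith
  have hρ' : Tendsto (fun x => (n x : ℝ) ^ (3 * ν) * a x (n x) / (2 * S (n x))) l
      (𝓝 (Q (u ^ (-ν)))) := by
    have h := hρ.add hQt
    simp only [zero_add, sub_add_cancel] at h
    exact h
  -- combine
  have hprod := (hσ.mul hte₂).mul hρ'
  refine hprod.congr' ?_
  have hσpos : ∀ᶠ x in l, 0 < v ^ (n x) * S (n x) / (n x : ℝ) ^ (γ - 1) :=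
    hσ.eventually (lt_mem_nhds hC)
  filter_upwards [hσpos, hr.eventually_gt_atTop 0, hnt'.eventually_ge_atTop 1] with x hσx hrx hnx
  rw [← hL, hcell x]
  have hn0 : (0 : ℝ) < n x := by exact_mod_cast hnx
  have hS : S (n x) ≠ 0 := by
    intro h0
    rw [h0, mul_zero, zero_div] at hσx
    exact lt_irrefl _ hσx
  have hnγ : (n x : ℝ) ^ (γ - 1) ≠ 0 := (Real.rpow_pos_of_pos hn0 _).ne'
  have hI1 : r x ^ (3 - γ / ν) * L x * (n x : ℝ) ^ (γ - 1 - 3 * ν) =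
      ((n x : ℝ) / L x) ^ (γ - 1 - 3 * ν) := by
    rw [hL]; exact rescale_rpow_eq hrx hn0 hν.ne'
  have hpow : (n x : ℝ) ^ (γ - 1 - 3 * ν) * (n x : ℝ) ^ (3 * ν) = (n x : ℝ) ^ (γ - 1) := by
    rw [← Real.rpow_add hn0]; ring_nf
  rw [← hI1]
  calc v ^ n x * S (n x) / (n x : ℝ) ^ (γ - 1) *
        (r x ^ (3 - γ / ν) * L x * (n x : ℝ) ^ (γ - 1 - 3 * ν)) *
        ((n x : ℝ) ^ (3 * ν) * a x (n x) / (2 * S (n x)))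
      = r x ^ (3 - γ / ν) * (L x / 2 * (a x (n x) * v ^ n x)) *
          (((n x : ℝ) ^ (γ - 1 - 3 * ν) * (n x : ℝ) ^ (3 * ν)) / (n x : ℝ) ^ (γ - 1)) *
          (S (n x) / S (n x)) := by ring
    _ = r x ^ (3 - γ / ν) * (L x / 2 * (a x (n x) * v ^ n x)) := by
        rw [hpow, div_self hnγ, div_self hS, mul_one, mul_one]

end Pointwise

end Summit.CriticalPhenomena.Ising3DConformalLimit.Theorems.KernelTransfer

end
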